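import Mathlib
import Summits.Ventures.PercRepro2.Defs
import Summits.Ventures.PercRepro2.Independence
import Summits.Ventures.PercRepro2.Harris
import Summits.Ventures.PercRepro2.Graph
import Summits.Ventures.PercRepro2.Exploration
import Summits.Ventures.PercRepro2.Events
import Summits.Ventures.PercRepro2.FourFunctions
import Summits.Ventures.PercRepro2.Induced
import Summits.Ventures.PercRepro2.Frontier
import Summits.Ventures.PercRepro2.ObsIndependence
import Summits.Ventures.PercRepro2.BHK
import Summits.Ventures.PercRepro2.BHKEvents
import Summits.Ventures.PercRepro2.OrderPreservation
import Summits.Ventures.PercRepro2.OrderPreservationDual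
import Summits.Ventures.PercRepro2.VdBKahn
import Summits.Ventures.PercRepro2.BHKAvoid
import Summits.Ventures.PercRepro2.R2PrimeThreeReduction
import Summits.Ventures.PercRepro2.YBridge
import Summits.Ventures.PercRepro2.Yu1Functionals
import Summits.Ventures.PercRepro2.Yu1Events
import Summits.Ventures.PercRepro2.Yu1
import Summits.Ventures.PercRepro2.LBSplit
import Summits.Ventures.PercRepro2.YDelta
import Summits.Ventures.PercRepro2.Y

/-!
# The `o ∈ C₁`-share of the R-order gap, and the covariance anatomy of `Z_0 + Z_h`
(blind cell PercRepro2, p1 g4; `proofs/LEAD-PROOFSHAPES.md` §8.9 ADDENDUM 17 (11)/(13),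
CONJECTURES rows 2′Z0h / 2′ZΔ)

Light-first vocabulary of `Yu1`/`YDelta` (`a₁` light, `a₂` heavy, `a₃` the third root, `o`, `b`;
`R = avoidAll a₁ {a₂, a₃} = {a₂, a₃ ∉ C₁}`, `PD`, `T = {a₁ ∉ C₂, a₃ ∈ C₂}`, `W = M₂ + Δ_T`).

* `gapR = P(b ∈ C₂, R) − P(b ∈ C₁, R)` — the R-order gap (`0 ≤ gapR` is `order_on_R`, R10d);
  `gapRoL = P(o ∈ C₁, b ∈ C₂, R) − P(o ∈ C₁, b ∈ C₁, R)` — its `o ∈ C₁`-part.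
* **`gapR_share`** (THEOREM, two BHK 1.3 steps): under the labelling,
  `P(PD) · gapRoL ≤ P(PD, o ∈ C₁) · gapR` — "the `o ∈ C₁`-share of the R-order gap is at most
  `g_l = P(o ∈ C₁ | PD)`".  The margin functional `θ = β − 1_b` is DECREASING in `C₁`, so one
  cross step (`f = 1_o`, `g = 1 + 1_b − β`) and one same-cluster step (`f = 1_o`, `g = u`) suffice
  — this is exactly the step that fails for the `a₃`-dressed margin of `Z_h` (NEG-32).
* **`Z0Zh_anatomy`** (identity): with `covL = P(PD) P(PD, o ∈ C₁, b ∈ C₁) − P(PD, o ∈ C₁) P(PD, b ∈ C₁)`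
  and `covH = P(PD) P(PD, o ∈ C₂, b ∈ C₁) − P(PD, o ∈ C₂) P(PD, b ∈ C₁)` (the PD-world
  covariances of `{b ∈ C₁}` with `{o ∈ C₁}` resp. `{o ∈ C₂}`),
  `Z_0 + Z_h = P(PD, o ∈ C₂) · gapR + [P(PD, o ∈ C₁) · gapR − P(PD) · gapRoL] − covL − covH`,
  where `Z_0 + Z_h = D_o · W − P(PD) · (T_{l→h} + T_{h→l} + Δ_T^o)` (the L2 rung of record,
  `Z0ZhNonneg_iff` form).  `covH ≤ P(PD, o ∈ C₂) · gapR` is (Yu2) (`yu2_cleared`), so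
  **`Z0Zh_of_covL_le`**: `Z_0 + Z_h ≥ 0` as soon as
  `covL ≤ [P(PD, o ∈ C₁) gapR − P(PD) gapRoL] + [P(PD, o ∈ C₂) gapR − covH]` — the open content
  of the L2 rung is the PD-world positive correlation of `{o ∈ C₁}` and `{b ∈ C₁}` against the
  two non-negative slacks (census: `covL ≤ P(PD, o ∈ C₁) gapR − P(PD) gapRoL + P(PD, o ∈ C₂) gapR`
  alone is 0 / 687 exact instances incl. 300 perturbations of the NEG-32 witnesses, (R2PD)).
-/

namespace Summit.Ventures.PercRepro2

open UnionCluster Yu1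

section RGapShare

variable {V : Type*} {E : Type*} [Fintype E] [DecidableEq E] [Fintype V] [DecidableEq V]
  {R : Type*} [Field R] [LinearOrder R] [IsStrictOrderedRing R]

/-- `gap_R = P(b ∈ C₂, R) − P(b ∈ C₁, R)`, `R = {a₂, a₃ ∉ C₁}` (the R-order gap). -/
noncomputable def gapR (p : E → R) (ends : E → Sym2 V) (a₁ a₂ a₃ b : V) : R :=
  prob p (connEvent ends a₂ b ∩ avoidAll ends a₁ {a₂, a₃}) -
    prob p (connEvent ends a₁ b ∩ avoidAll ends a₁ {a₂, a₃})

/-- `gap_R^{oL} = P(o ∈ C₁, b ∈ C₂, R) − P(o ∈ C₁, b ∈ C₁, R)`: the `o ∈ C₁`-part of the R-order gap. -/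
noncomputable def gapRoL (p : E → R) (ends : E → Sym2 V) (o a₁ a₂ a₃ b : V) : R :=
  prob p (connEvent ends a₁ o ∩ connEvent ends a₂ b ∩ avoidAll ends a₁ {a₂, a₃}) -
    prob p (connEvent ends a₁ o ∩ connEvent ends a₁ b ∩ avoidAll ends a₁ {a₂, a₃})

/-- The labelling gives `0 ≤ gapR` (`order_on_R`, R10d). -/
lemma gapR_nonneg (p : E → R) (hp : IsProbVec p) (ends : E → Sym2 V) {a₁ a₂ a₃ b : V}
    (hord : prob p (connEvent ends a₁ b) ≤ prob p (connEvent ends a₂ b)) :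
    0 ≤ gapR p ends a₁ a₂ a₃ b := by
  unfold gapR
  linarith [order_on_R p hp ends (a₃ := a₃) hord]

omit [LinearOrder R] [IsStrictOrderedRing R] in
/-- Tower identity: `P(o ∈ C₁, b ∈ C₂, R) = E[1_o(C₁) β(C₁); R]`. -/
lemma tower_ob_beta (p : E → R) (ends : E → Sym2 V) (o a₁ a₂ a₃ b : V) :
    prob p (connEvent ends a₁ o ∩ connEvent ends a₂ b ∩ avoidAll ends a₁ {a₂, a₃}) =
      expect p (fun ω => ind o (cluster ends ω a₁) * beta p ends a₂ b (cluster ends ω a₁) *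
        (avoidAll ends a₁ {a₂, a₃}).indicator 1 ω) := by
  rw [connEvent_eq_clusterInEvent ends a₁ o, connEvent_eq_clusterInEvent ends a₂ b,
    prob_clusterIn_inter_avoid_eq_expect p ends a₁ a₂ (X := {a₂, a₃})
      (Finset.mem_insert_self a₂ {a₃})]
  rfl

omit [Fintype V] [LinearOrder R] [IsStrictOrderedRing R] in
/-- `P(o ∈ C₁, b ∈ C₁, R) = E[1_o(C₁) 1_b(C₁); R]`. -/
lemma tower_ob_ind (p : E → R) (ends : E → Sym2 V) (o a₁ a₂ a₃ b : V) :
    prob p (connEvent ends a₁ o ∩ connEvent ends a₁ b ∩ avoidAll ends a₁ {a₂, a₃}) =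
      expect p (fun ω => ind o (cluster ends ω a₁) * ind b (cluster ends ω a₁) *
        (avoidAll ends a₁ {a₂, a₃}).indicator 1 ω) := by
  rw [prob_eq_expect_indicator]
  unfold expect
  refine Finset.sum_congr rfl fun ω _ => ?_
  congr 1
  rw [indicator_inter_one, indicator_inter_one]
  rfl

/-- **Cross step**: BHK 1.3 with `f = 1_o` (increasing) and `g = 1 + 1_b − β` (increasing), i.e.
`E[1_o θ; R] · P(R) ≤ E[1_o; R] · E[θ; R]` for the decreasing margin `θ = β − 1_b`, cleared:
`gapRoL · P(R) ≤ P(o ∈ C₁, R) · gapR`. -/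
lemma gapRoL_mul_le (p : E → R) (hp : IsProbVec p) (ends : E → Sym2 V) (o a₁ a₂ a₃ b : V) :
    gapRoL p ends o a₁ a₂ a₃ b * prob p (avoidAll ends a₁ {a₂, a₃}) ≤
      prob p (connEvent ends a₁ o ∩ avoidAll ends a₁ {a₂, a₃}) * gapR p ends a₁ a₂ a₃ b := by
  have h := bhk_induced p hp ends a₁ (F₁ := (ind o : Set V → R))
    (F₂ := fun W => 1 + ind b W - beta p ends a₂ b W)
    (ind_mono o)
    (fun W W' hW => by
      have h1 := ind_mono (R := R) b hW
      have h2 := beta_anti p hp ends a₂ b hW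
      linarith)
    (ind_nonneg o)
    (fun W => by
      have h1 := ind_nonneg (R := R) b W
      have h2 := beta_le_one p hp ends a₂ b W
      linarith)
    Finset.univ {a₂, a₃} {a₂, a₃} (Finset.subset_univ _) (Finset.subset_univ _)
  simp only [REvent_univ, Finset.inter_self, Finset.union_self, expect_clusterObs_univ,
    Pi.mul_apply] at h
  -- expand the two expectations
  have e1 : expect p (fun ω => (1 + ind b (cluster ends ω a₁) - beta p ends a₂ b (cluster ends ω a₁)) *
      (avoidAll ends a₁ {a₂, a₃}).indicator 1 ω) =
      prob p (avoidAll ends a₁ {a₂, a₃}) +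
        expect p (fun ω => ind b (cluster ends ω a₁) * (avoidAll ends a₁ {a₂, a₃}).indicator 1 ω) -
        expect p (fun ω => beta p ends a₂ b (cluster ends ω a₁) *
          (avoidAll ends a₁ {a₂, a₃}).indicator 1 ω) := by
    rw [prob_eq_expect_indicator, ← expect_add, ← expect_sub]
    congr 1
    funext ω
    simp only [Pi.add_apply, Pi.sub_apply]
    ring
  have e2 : expect p (fun ω => ind o (cluster ends ω a₁) *
      (1 + ind b (cluster ends ω a₁) - beta p ends a₂ b (cluster ends ω a₁)) *
      (avoidAll ends a₁ {a₂, a₃}).indicator 1 ω) =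
      expect p (fun ω => ind o (cluster ends ω a₁) * (avoidAll ends a₁ {a₂, a₃}).indicator 1 ω) +
        expect p (fun ω => ind o (cluster ends ω a₁) * ind b (cluster ends ω a₁) *
          (avoidAll ends a₁ {a₂, a₃}).indicator 1 ω) -
        expect p (fun ω => ind o (cluster ends ω a₁) * beta p ends a₂ b (cluster ends ω a₁) *
          (avoidAll ends a₁ {a₂, a₃}).indicator 1 ω) := by
    rw [← expect_add, ← expect_sub]
    congr 1
    funext ω
    simp only [Pi.add_apply, Pi.sub_apply]
    ring
  rw [e1, e2] at h
  unfold gapRoL gapR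
  rw [tower_ob_beta, tower_ob_ind, tower_N, tower_b p ends a₁ a₂ a₃ b, tower_b p ends a₁ a₂ a₃ o]
  nlinarith [h]

/-- **Same-cluster step**: `P(o ∈ C₁, R) · P(PD) ≤ P(PD, o ∈ C₁) · P(R)` (BHK 1.3, `f = 1_o`, `g = u`;
this is `bhk_step3` read at `o`). -/
lemma oR_mul_PD_le (p : E → R) (hp : IsProbVec p) (ends : E → Sym2 V) (o a₁ a₂ a₃ : V) :
    prob p (connEvent ends a₁ o ∩ avoidAll ends a₁ {a₂, a₃}) * prob p (PDEvent ends a₁ a₂ a₃) ≤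
      prob p (PDEvent ends a₁ a₂ a₃ ∩ connEvent ends a₁ o) * prob p (avoidAll ends a₁ {a₂, a₃}) := by
  have h := bhk_step3 p hp ends a₁ a₂ a₃ o
  rw [tower_b p ends a₁ a₂ a₃ o, tower_PD, tower_PDo]
  exact h

/-- **The `o ∈ C₁`-share of the R-order gap is at most `g_l`** (THEOREM): under the labelling
`P(b ↔ a₁) ≤ P(b ↔ a₂)`, `P(PD) · gapRoL ≤ P(PD, o ∈ C₁) · gapR`.  (This is the R-gap
analogue of the L1 rung `Z_h ≥ 0`, which asks the same with the `a₃`-dressed margin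
`Δ_T`; the dressing destroys the monotonicity of the margin functional.) -/
theorem gapR_share (p : E → R) (hp : IsProbVec p) (ends : E → Sym2 V) {o a₁ a₂ a₃ b : V}
    (hord : prob p (connEvent ends a₁ b) ≤ prob p (connEvent ends a₂ b)) :
    prob p (PDEvent ends a₁ a₂ a₃) * gapRoL p ends o a₁ a₂ a₃ b ≤
      prob p (PDEvent ends a₁ a₂ a₃ ∩ connEvent ends a₁ o) * gapR p ends a₁ a₂ a₃ b := by
  have h1 := gapRoL_mul_le p hp ends o a₁ a₂ a₃ b
  have h2 := oR_mul_PD_le p hp ends o a₁ a₂ a₃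
  have hg := gapR_nonneg p hp ends (a₃ := a₃) hord
  have hPD0 : 0 ≤ prob p (PDEvent ends a₁ a₂ a₃) := prob_nonneg hp _
  have hPDo0 : 0 ≤ prob p (PDEvent ends a₁ a₂ a₃ ∩ connEvent ends a₁ o) := prob_nonneg hp _
  rcases (prob_nonneg hp (avoidAll ends a₁ {a₂, a₃})).lt_or_eq with hpos | hzero
  · refine le_of_mul_le_mul_right ?_ hpos
    calc prob p (PDEvent ends a₁ a₂ a₃) * gapRoL p ends o a₁ a₂ a₃ b *
          prob p (avoidAll ends a₁ {a₂, a₃})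
        = prob p (PDEvent ends a₁ a₂ a₃) *
            (gapRoL p ends o a₁ a₂ a₃ b * prob p (avoidAll ends a₁ {a₂, a₃})) := by ring
      _ ≤ prob p (PDEvent ends a₁ a₂ a₃) *
            (prob p (connEvent ends a₁ o ∩ avoidAll ends a₁ {a₂, a₃}) * gapR p ends a₁ a₂ a₃ b) :=
          mul_le_mul_of_nonneg_left h1 hPD0
      _ = (prob p (connEvent ends a₁ o ∩ avoidAll ends a₁ {a₂, a₃}) * prob p (PDEvent ends a₁ a₂ a₃)) *
            gapR p ends a₁ a₂ a₃ b := by ring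
      _ ≤ (prob p (PDEvent ends a₁ a₂ a₃ ∩ connEvent ends a₁ o) * prob p (avoidAll ends a₁ {a₂, a₃})) *
            gapR p ends a₁ a₂ a₃ b := mul_le_mul_of_nonneg_right h2 hg
      _ = prob p (PDEvent ends a₁ a₂ a₃ ∩ connEvent ends a₁ o) * gapR p ends a₁ a₂ a₃ b *
            prob p (avoidAll ends a₁ {a₂, a₃}) := by ring
  · -- `P(R) = 0`: `P(PD) = 0` and `P(PD, o ∈ C₁) = 0`
    have hsub : PDEvent ends a₁ a₂ a₃ ⊆ avoidAll ends a₁ {a₂, a₃} := by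
      intro ω hω
      rw [← PD_event_eq] at hω
      exact hω.2
    have hPD : prob p (PDEvent ends a₁ a₂ a₃) = 0 :=
      le_antisymm (hzero ▸ prob_mono hp hsub) hPD0
    have hPDo : prob p (PDEvent ends a₁ a₂ a₃ ∩ connEvent ends a₁ o) = 0 :=
      le_antisymm (hzero ▸ prob_mono hp (Set.inter_subset_left.trans hsub)) hPDo0
    rw [hPD, hPDo]
    simp

end RGapShare

section Anatomy

variable {V : Type*} {E : Type*} [Fintype E] [DecidableEq E] [Fintype V] [DecidableEq V]
  {R : Type*} [Field R] [LinearOrder R] [IsStrictOrderedRing R]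

omit [Fintype E] [DecidableEq E] [Fintype V] in
/-- `X ∩ R ∩ {a₂ ↔ a₃} = T ∩ X`. -/
lemma inter_avoid_inter_conn_eq (ends : E → Sym2 V) (a₁ a₂ a₃ : V) (X : Set (Config E)) :
    X ∩ avoidAll ends a₁ {a₂, a₃} ∩ connEvent ends a₂ a₃ = TEvent ends a₁ a₂ a₃ ∩ X := by
  ext ω
  simp only [Set.mem_inter_iff, mem_connEvent, avoidAll, Finset.mem_insert, Finset.mem_singleton,
    TEvent, Set.mem_setOf_eq, Set.mem_compl_iff]
  constructor
  · rintro ⟨⟨hX, hR⟩, h23⟩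
    exact ⟨⟨fun h' => hR _ (Or.inl rfl) (conn_symm h'), h23⟩, hX⟩
  · rintro ⟨⟨h21, h23⟩, hX⟩
    refine ⟨⟨hX, ?_⟩, h23⟩
    intro x hx
    rcases hx with rfl | rfl
    · exact fun h' => h21 (conn_symm h')
    · exact fun h' => h21 (conn_trans h23 (conn_symm h'))

omit [Fintype E] [DecidableEq E] [Fintype V] in
/-- `X ∩ R ∩ {a₂ ↮ a₃} = PD ∩ X`. -/
lemma inter_avoid_inter_compl_eq (ends : E → Sym2 V) (a₁ a₂ a₃ : V) (X : Set (Config E)) :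
    X ∩ avoidAll ends a₁ {a₂, a₃} ∩ (connEvent ends a₂ a₃)ᶜ = PDEvent ends a₁ a₂ a₃ ∩ X := by
  ext ω
  simp only [Set.mem_inter_iff, mem_connEvent, avoidAll, Finset.mem_insert, Finset.mem_singleton,
    PDEvent, Dtilde, inU, Set.mem_compl_iff, Set.mem_union]
  constructor
  · rintro ⟨⟨hX, hR⟩, h23⟩
    exact ⟨⟨hR _ (Or.inl rfl), fun h' => h'.elim (fun h' => hR _ (Or.inr rfl) (conn_symm h'))
      (fun h' => h23 (conn_symm h'))⟩, hX⟩
  · rintro ⟨⟨h12, h3⟩, hX⟩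
    refine ⟨⟨hX, ?_⟩, fun h' => h3 (Or.inr (conn_symm h'))⟩
    intro x hx
    rcases hx with rfl | rfl
    · exact h12
    · exact fun h' => h3 (Or.inl (conn_symm h'))

omit [Fintype V] [LinearOrder R] [IsStrictOrderedRing R] in
/-- **The R-world splits along `a₃ ∈ C₂`**: `P(X ∩ R) = P(PD ∩ X) + P(T ∩ X)` for every event `X`. -/
lemma prob_split_R (p : E → R) (ends : E → Sym2 V) (a₁ a₂ a₃ : V) (X : Set (Config E)) :
    prob p (X ∩ avoidAll ends a₁ {a₂, a₃}) =
      prob p (PDEvent ends a₁ a₂ a₃ ∩ X) + prob p (TEvent ends a₁ a₂ a₃ ∩ X) := by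
  have h := prob_inter_add_prob_inter_compl p (X ∩ avoidAll ends a₁ {a₂, a₃}) (connEvent ends a₂ a₃)
  rw [inter_avoid_inter_conn_eq, inter_avoid_inter_compl_eq] at h
  rw [← h, add_comm]

/-- `covL = P(PD) · P(PD, o ∈ C₁, b ∈ C₁) − P(PD, o ∈ C₁) · P(PD, b ∈ C₁)` (the PD-world covariance
of `{o ∈ C₁}` and `{b ∈ C₁}`, cleared by `P(PD)²`). -/
noncomputable def covL (p : E → R) (ends : E → Sym2 V) (o a₁ a₂ a₃ b : V) : R :=
  prob p (PDEvent ends a₁ a₂ a₃) *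
      prob p (PDEvent ends a₁ a₂ a₃ ∩ connEvent ends a₁ o ∩ connEvent ends a₁ b) -
    prob p (PDEvent ends a₁ a₂ a₃ ∩ connEvent ends a₁ o) *
      prob p (PDEvent ends a₁ a₂ a₃ ∩ connEvent ends a₁ b)

/-- `covH = P(PD) · P(PD, o ∈ C₂, b ∈ C₁) − P(PD, o ∈ C₂) · P(PD, b ∈ C₁)` (the PD-world covariance
of `{o ∈ C₂}` and `{b ∈ C₁}`, cleared by `P(PD)²`; `P(PD, o ∈ C₂, b ∈ C₁) = T_{h→l}`). -/
noncomputable def covH (p : E → R) (ends : E → Sym2 V) (o a₁ a₂ a₃ b : V) : R :=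
  prob p (PDEvent ends a₁ a₂ a₃) *
      prob p (PDEvent ends a₁ a₂ a₃ ∩ connEvent ends a₂ o ∩ connEvent ends a₁ b) -
    prob p (PDEvent ends a₁ a₂ a₃ ∩ connEvent ends a₂ o) *
      prob p (PDEvent ends a₁ a₂ a₃ ∩ connEvent ends a₁ b)

omit [Fintype V] [LinearOrder R] [IsStrictOrderedRing R] in
/-- `W = M₂ + Δ_T = gapR + P(PD, b ∈ C₁)`. -/
lemma W_eq_gapR_add (p : E → R) (ends : E → Sym2 V) (a₁ a₂ a₃ b : V) :
    massM2 p ends a₁ a₂ a₃ b + deltaT p ends a₁ a₂ a₃ b =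
      gapR p ends a₁ a₂ a₃ b + prob p (PDEvent ends a₁ a₂ a₃ ∩ connEvent ends a₁ b) := by
  unfold massM2 deltaT gapR
  rw [prob_split_R p ends a₁ a₂ a₃ (connEvent ends a₂ b),
    prob_split_R p ends a₁ a₂ a₃ (connEvent ends a₁ b),
    Set.inter_comm (connEvent ends a₂ b) (TEvent ends a₁ a₂ a₃),
    Set.inter_comm (connEvent ends a₁ b) (TEvent ends a₁ a₂ a₃)]
  ring

omit [Fintype V] [LinearOrder R] [IsStrictOrderedRing R] in
/-- `T_{l→h} + Δ_T^o = gapRoL + P(PD, o ∈ C₁, b ∈ C₁)` (with `Δ_T^o = P(T, o ∈ C₁, b ∈ C₂) − P(T, o ∈ C₁, b ∈ C₁)`). -/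
lemma WoL_eq_gapRoL_add (p : E → R) (ends : E → Sym2 V) (o a₁ a₂ a₃ b : V) :
    prob p (PDEvent ends a₁ a₂ a₃ ∩ connEvent ends a₁ o ∩ connEvent ends a₂ b) +
        (prob p (TEvent ends a₁ a₂ a₃ ∩ connEvent ends a₁ o ∩ connEvent ends a₂ b) -
          prob p (TEvent ends a₁ a₂ a₃ ∩ connEvent ends a₁ o ∩ connEvent ends a₁ b)) =
      gapRoL p ends o a₁ a₂ a₃ b +
        prob p (PDEvent ends a₁ a₂ a₃ ∩ connEvent ends a₁ o ∩ connEvent ends a₁ b) := by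
  unfold gapRoL
  rw [prob_split_R p ends a₁ a₂ a₃ (connEvent ends a₁ o ∩ connEvent ends a₂ b),
    prob_split_R p ends a₁ a₂ a₃ (connEvent ends a₁ o ∩ connEvent ends a₁ b),
    ← Set.inter_assoc (PDEvent ends a₁ a₂ a₃), ← Set.inter_assoc (PDEvent ends a₁ a₂ a₃),
    ← Set.inter_assoc (TEvent ends a₁ a₂ a₃), ← Set.inter_assoc (TEvent ends a₁ a₂ a₃)]
  ring

omit [Fintype V] [LinearOrder R] [IsStrictOrderedRing R] in
/-- **The covariance anatomy of the L2 rung** (identity): with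
`Z_0 + Z_h = D_o · W − P(PD) · (T_{l→h} + T_{h→l} + Δ_T^o)` (`Z0ZhNonneg_iff` form),
`Z_0 + Z_h = P(PD, o ∈ C₂) · gapR + [P(PD, o ∈ C₁) · gapR − P(PD) · gapRoL] − covL − covH`. -/
theorem Z0Zh_anatomy (p : E → R) (ends : E → Sym2 V) (o a₁ a₂ a₃ b : V) :
    (prob p (PDEvent ends a₁ a₂ a₃ ∩ connEvent ends a₁ o) +
          prob p (PDEvent ends a₁ a₂ a₃ ∩ connEvent ends a₂ o)) *
        (massM2 p ends a₁ a₂ a₃ b + deltaT p ends a₁ a₂ a₃ b) -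
      prob p (PDEvent ends a₁ a₂ a₃) *
        (prob p (PDEvent ends a₁ a₂ a₃ ∩ connEvent ends a₁ o ∩ connEvent ends a₂ b) +
          prob p (PDEvent ends a₁ a₂ a₃ ∩ connEvent ends a₂ o ∩ connEvent ends a₁ b) +
          (prob p (TEvent ends a₁ a₂ a₃ ∩ connEvent ends a₁ o ∩ connEvent ends a₂ b) -
            prob p (TEvent ends a₁ a₂ a₃ ∩ connEvent ends a₁ o ∩ connEvent ends a₁ b))) =
      prob p (PDEvent ends a₁ a₂ a₃ ∩ connEvent ends a₂ o) * gapR p ends a₁ a₂ a₃ b +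
        (prob p (PDEvent ends a₁ a₂ a₃ ∩ connEvent ends a₁ o) * gapR p ends a₁ a₂ a₃ b -
          prob p (PDEvent ends a₁ a₂ a₃) * gapRoL p ends o a₁ a₂ a₃ b) -
        covL p ends o a₁ a₂ a₃ b - covH p ends o a₁ a₂ a₃ b := by
  have h1 := W_eq_gapR_add p ends a₁ a₂ a₃ b
  have h2 := WoL_eq_gapRoL_add p ends o a₁ a₂ a₃ b
  unfold covL covH
  rw [h1]
  linear_combination (-(prob p (PDEvent ends a₁ a₂ a₃))) * h2

/-- `covH ≤ P(PD, o ∈ C₂) · gapR` is **(Yu2)** (`yu2_cleared`). -/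
theorem covH_le (p : E → R) (hp : IsProbVec p) (ends : E → Sym2 V) {o a₁ a₂ a₃ b : V}
    (hord : prob p (connEvent ends a₁ b) ≤ prob p (connEvent ends a₂ b)) :
    covH p ends o a₁ a₂ a₃ b ≤
      prob p (PDEvent ends a₁ a₂ a₃ ∩ connEvent ends a₂ o) * gapR p ends a₁ a₂ a₃ b := by
  have h := yu2_cleared p hp ends (o := o) (a₃ := a₃) hord
  rw [W_eq_gapR_add] at h
  unfold covH
  linarith

omit [Fintype V] in
/-- **The L2 rung from a bound on the light covariance**: if
`covL ≤ [P(PD, o ∈ C₁) gapR − P(PD) gapRoL] + [P(PD, o ∈ C₂) gapR − covH]` (both brackets are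
non-negative: `gapR_share` and `covH_le`), then `Z_0 + Z_h ≥ 0` in the `Z0ZhNonneg_iff` form. -/
theorem Z0Zh_of_covL_le (p : E → R) (ends : E → Sym2 V) {o a₁ a₂ a₃ b : V}
    (h : covL p ends o a₁ a₂ a₃ b ≤
      (prob p (PDEvent ends a₁ a₂ a₃ ∩ connEvent ends a₁ o) * gapR p ends a₁ a₂ a₃ b -
          prob p (PDEvent ends a₁ a₂ a₃) * gapRoL p ends o a₁ a₂ a₃ b) +
        (prob p (PDEvent ends a₁ a₂ a₃ ∩ connEvent ends a₂ o) * gapR p ends a₁ a₂ a₃ b -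
          covH p ends o a₁ a₂ a₃ b)) :
    prob p (PDEvent ends a₁ a₂ a₃) *
        (prob p (PDEvent ends a₁ a₂ a₃ ∩ connEvent ends a₁ o ∩ connEvent ends a₂ b) +
          prob p (PDEvent ends a₁ a₂ a₃ ∩ connEvent ends a₂ o ∩ connEvent ends a₁ b) +
          (prob p (TEvent ends a₁ a₂ a₃ ∩ connEvent ends a₁ o ∩ connEvent ends a₂ b) -
            prob p (TEvent ends a₁ a₂ a₃ ∩ connEvent ends a₁ o ∩ connEvent ends a₁ b))) ≤
      (prob p (PDEvent ends a₁ a₂ a₃ ∩ connEvent ends a₁ o) +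
          prob p (PDEvent ends a₁ a₂ a₃ ∩ connEvent ends a₂ o)) *
        (massM2 p ends a₁ a₂ a₃ b + deltaT p ends a₁ a₂ a₃ b) := by
  have e := Z0Zh_anatomy p ends o a₁ a₂ a₃ b
  linarith

/-- **(R2PD)**, the census-true strengthening of the L2 rung (0 / 687 exact instances incl. 300
perturbations of the NEG-32 witnesses): `covL ≤ [P(PD, o ∈ C₁) gapR − P(PD) gapRoL] + P(PD, o ∈ C₂) gapR`,
i.e. `σ_l + P(PD, o ∈ C₂) · gapR ≥ 0` — the PD-world positive correlation of `{o ∈ C₁}` and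
`{b ∈ C₁}` is paid by the `o`-share slack of the R-order gap.  OPEN. -/
def LightCovBound (p : E → R) (ends : E → Sym2 V) (o a₁ a₂ a₃ b : V) : Prop :=
  covL p ends o a₁ a₂ a₃ b ≤
    (prob p (PDEvent ends a₁ a₂ a₃ ∩ connEvent ends a₁ o) * gapR p ends a₁ a₂ a₃ b -
        prob p (PDEvent ends a₁ a₂ a₃) * gapRoL p ends o a₁ a₂ a₃ b) +
      prob p (PDEvent ends a₁ a₂ a₃ ∩ connEvent ends a₂ o) * gapR p ends a₁ a₂ a₃ b

omit [Fintype V] in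
/-- `LightCovBound` together with `covH ≤ 0` (the PD-world negative correlation of `{o ∈ C₂}`
and `{b ∈ C₁}` — census: fails on 8 / 687 instances by at most `1.8e−8`, so NOT a theorem; kept
as the bridge for the record) gives the L2 rung. -/
theorem Z0Zh_of_LightCovBound (p : E → R) (ends : E → Sym2 V) {o a₁ a₂ a₃ b : V}
    (hL : LightCovBound p ends o a₁ a₂ a₃ b) (hH : covH p ends o a₁ a₂ a₃ b ≤ 0) :
    prob p (PDEvent ends a₁ a₂ a₃) *
        (prob p (PDEvent ends a₁ a₂ a₃ ∩ connEvent ends a₁ o ∩ connEvent ends a₂ b) +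
          prob p (PDEvent ends a₁ a₂ a₃ ∩ connEvent ends a₂ o ∩ connEvent ends a₁ b) +
          (prob p (TEvent ends a₁ a₂ a₃ ∩ connEvent ends a₁ o ∩ connEvent ends a₂ b) -
            prob p (TEvent ends a₁ a₂ a₃ ∩ connEvent ends a₁ o ∩ connEvent ends a₁ b))) ≤
      (prob p (PDEvent ends a₁ a₂ a₃ ∩ connEvent ends a₁ o) +
          prob p (PDEvent ends a₁ a₂ a₃ ∩ connEvent ends a₂ o)) *
        (massM2 p ends a₁ a₂ a₃ b + deltaT p ends a₁ a₂ a₃ b) := by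
  apply Z0Zh_of_covL_le p ends
  unfold LightCovBound at hL
  linarith

end Anatomy

end Summit.Ventures.PercRepro2
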